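import Literature.MathematicalPhysics.QuantumFieldTheory.Balaban1983to89.B9Eq326DeltaAHermitianZd
import Literature.MathematicalPhysics.QuantumFieldTheory.Balaban1983to89.B9Eq327GreenZdHerm

/-!
# `Balaban1983to89.B9Eq326DeltaAHermitianZdCurved` — [Balaban1985BackgroundPropagators] (3.16) p. 393, (3.26) p. 395 at a CURVED background:
# the linearised covariant average of [Balaban1985Averaging] Prop. 3 (122) is REAL at a unitary background, hence `Q*aQ(U₀)` and the
# four-letter `Δ_a(U₀)` of the genuine record are ℝ-linear and Hermitian-preserving for every `U₀` in the class (1.7) on `ℤᵈ`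

statement-level skeleton of published theorems with citation tags; proofs where landed; nothing here is a claim about the
Yang–Mills mass gap

PDF held: `paper:balaban1985-cmp99-background-propagators` (journal page = PDF page + 388): p. 391 («functions defined on bonds with values in the algebra
𝔤 of hermitian matrices»), (3.16) p. 393 («we define an operator Q*aQ»), (3.26) p. 395 («Δ_a = Δ + DRD* + Q*aQ»); [Balaban1985Averaging] ("B7" = B9's [5],
CMP **98**; journal page = PDF page + 16): (22)–(23) p. 21 (the logarithm of a unitary close to `1` is `i`·hermitian), (42) p. 23, (82) p. 30, (89) p. 31,
(120) p. 35, (121)–(122) p. 36 («Q(V₀, A, c) = (1∕i) log(V̿₁)_c … its Taylor expansion begins with a first-order polynomial. Let us denote it by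
L(Q(V₀)A)_c»), (127) p. 37; [Balaban1985RegularSpaces] ("B8") (1.7) p. 77 (the class `𝔄`), (1.58) p. 86.  BY NAME (nothing restated): the b2b-t4 lineage's
`B7Prop3GeneralLinear.Qcov ∕ linQcov` (121)–(122), `B7Prop3GeneralTild.hasDerivAt_Qcov ∕ linQcov_add ∕ linQcov_smul` (120), `B7Prop3GeneralRotated`
(`hasDerivAt_tHol_expCfg`), `B7Eq92Concrete` (`dbavgCov ∕ tild ∕ wframe`), the unitarity lemmas `B7Prop2Explicit.star_mlog_eq_neg ∕ bavg_mem_unitaryUnits ∕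
avgIter_mem`, `B8Prop7AdmittedFamily.wframe_mem_unitaryUnits ∕ tHol_mem_unitaryUnits`, `B7Prop8PrintedConstants.Rc_mem_unitaryUnits`,
`B7Prop5GeneralLevels.level_loops`, `B7Prop4GeneralLevels.linCovIter`, `B9Ineq3137LocalSup.linCovIter_congr` (locality); dag-n06-b's `B9Eq316AveragingTransposeZd`
(`entryT ∕ linCovIterT ∕ clsField ∕ Reg17 ∕ alphaQ`), `…Printed` (`QQZdP ∕ withQQP ∕ reg17_shift`), `…Linear` (`linCovIter_add∕smul_of_reg17`, `clsField_add∕smul_of_reg17`,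
`linCovIterT_add∕smul`, `entryT_smul`), `B9Eq327GreenZdHerm` (`domSubH ∕ HermPreservingAt`); dag-n06-w4's `B9SupplySockB9P3ZdAllLettersZd.opsAllZd`,
`B9SupplySockB9P3ZdGenuineGop` (`QQLinearAt ∕ linearOnDomAt_opsGenuine`), `B9Eq327GreenZd.LinearOnDomAt`; dag-n06-w2 g2's `B9Eq326DeltaAHermitianZd`
(`isSelfAdjoint_entryT`, `bump_add ∕ bump_smul ∕ star_bump`, `isSelfAdjoint_deltaAOf_opsAllZd_of_QQ`); Mathlib `HasDerivAt.star` (𝕜 = ℝ), `HasDerivAt.scomp`,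
`NormedSpace.exp_mem_unitary_of_mem_skewAdjoint`.

WHY THIS FILE (cell `pub-ymgap`, HUMAN RULING D-0062 ∕ D-0149; seat `pub-ymgap-dag-n06-w2` (g3), node N06 = [B9]; CLAIM-1; count-neutral).  The per-member road to
[B9] Thm 3.11 (dag-n06-b g18: `RegularAtH ⟸` positivity + `LinearOnDomAt` + `HermPreservingAt`; dag-n06-w4 g3's step-(ii) engine
`B9Thm311PosDefOpenZd.regularAtH_eventually_one_cube`) needs the two STRUCTURAL inputs `hlin : ∀ U₀ ∈ 𝒰, LinearOnDomAt …` and `hherm : ∀ U₀ ∈ 𝒰,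
HermPreservingAt …` on a background SET `𝒰 ∋ 1`, for print's class `cubeLamBP` whose level-0 crossing bonds violate the box clause of dag-n06-b's `QQZdP_add`.
In the tree both were available at `U₀ = 1` only (`B9Thm311FlatGreenZdHerm`, g2's `isSelfAdjoint_deltaAOf_opsAllZd_one`); at a curved unitary `U₀` the
Hermiticity of the averaging letter is the REALITY of [5] (122)'s linear part — displayed, not proved, in g2's `isSelfAdjoint_deltaAOf_opsAllZd_of_QQ`.  This
file proves that reality and delivers both inputs on `𝒰 := {U₀ unitary-valued, (1.7) on Ω ≡ ℤᵈ up to level m at window α_Q}` (no box clause, any class).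

WHAT IS PROVED (kernel, 0 sorry; proof lane — no `def`).
* §1 `expCfg_real_smul_mem_unitaryUnits` · `dbavgCov_mem_unitaryUnits` (the double-bar average (89) of a unitary configuration at a unitary background is unitary,
  given the four «within 1∕4 of 1» clauses) · `differentiableAt_dbavgCov_expCfg` · ★★★ `star_linQcov_of_skew` — for unitary `V₀` with block loops
  `‖W_x(V₀) − 1‖ < 1∕4` and skew-Hermitian `B`: `(L(Q(V₀)B)_c)* = −L(Q(V₀)B)_c` · ★ `linQcov_star` — `L(Q(V₀)B*)_c = (L(Q(V₀)B)_c)*` for EVERY `B`.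
* §2 `hstar_levels` · `linCovIter_star_of_levels` · ★ `linCovIter_star_of_pdev` — the composite (127) commutes with the involution at a globally regular unitary
  background (`|U₀(∂p) − 1| < α₀L^{−2k}`, Prop.-2 window), `j ≤ k`, all fields.
* §3 ★ `linCovIter_star_of_reg17` · `star_linCovIter_of_reg17_of_skew` — the same AT A CLASS BOND of print's class (1.7) (unitary `U₀ ∈ 𝔄` up to level `m`,
  `α ≤ α_Q`, box `⊂ Ω_j`; clamping + locality, dag-n06-b's `clamp_data` pattern).
* §4 `isSelfAdjoint_linCovIterT_zero` · ★ `isSelfAdjoint_linCovIterT_of_reg17` (`Q_jᵀB` Hermitian-valued for Hermitian `B` carried by class bonds; box clause for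
  `j ≥ 1` only — `Q₀ = 1`) · `star_iEta_of_isSelfAdjoint` · `isSelfAdjoint_clsField_zero` · ★ `isSelfAdjoint_clsField_of_reg17` · `clsField_eq_zero_of_not_mem` ·
  ★★ `isSelfAdjoint_QQZdP_of_box` (LEVEL-0-EXEMPT box-clause form «P₀»: EVERY unitary `U₀`; the Hermitian mirror of dag-n06-b's `QQZdP_add₀`) · `box_univ` ·
  ★★ `isSelfAdjoint_QQZdP_of_reg17Univ` · ★ `QQZdP_add_of_reg17Univ` · ★ `QQZdP_smul_real_of_reg17Univ` · `qqLinearAt_withQQP_of_reg17Univ` (NO box clause: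
  `U₀` in (1.7) on `Ω ≡ ℤᵈ`, ANY class `ΛbP`).
* §5 ★★★ `linearOnDomAt_opsAllZd_of_reg17Univ` · ★★★ `hermPreservingAt_opsAllZd_of_reg17Univ` (finite `Ω₀`, `L ≥ 2`, any class, faithful Hermitian tracial `τ`
  on a finite-dimensional fibre) · ★★ `hermPreservingAt_opsAllZd_of_box` (P₀ box-law classes, e.g. `cubeLamBP`: EVERY unitary `U₀`, no regime hypothesis; its linear
  twin is dag-n06-b g19's `linearOnDomAt_opsAllZd_of_unitary₀`) · `one_mem_reg17Univ` (A6: `1 ∈ 𝒰`) · ★★ `linear_herm_on_reg17Univ` (the `hlin` ∧ `hherm` package on `𝒰`) ·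
  `reg17Univ_of_reg17UnivP` · `one_mem_reg17UnivP` · ★★ `linear_herm_on_reg17UnivP` (the same on `𝒰′` = window `α_Q∕L²`, dag-n06-w3 g3's regime set).
HONEST SCOPE.  Involution bookkeeping plus ONE analytic lemma (reality of [5] (122)'s linear part at a unitary background); no estimate; Thm 3.11 at curved
`U₀` NOT proved (letter continuity = dag-n06-w4 g3's files 2–4; gauge covariance = dag-n06-w3 g3); count-neutral helper of K1⁷; N05∕N06 NOT discharged; one
finite lattice programme at fixed `ε`; R4 closes the conditional finite-𝕋⁴ rung `BalabanLadder.UV` only; nothing continuum ∕ ℝ⁴ ∕ OS ∕ mass-gap ∕ Clay.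
Unit `pub-ymgap-dag-n06-w2` (g3), 2026-08-28.
-/

noncomputable section

open scoped Topology
open Filter NormedSpace

namespace Literature.MathematicalPhysics.QuantumFieldTheory.Balaban1983to89.B9Eq326DeltaAHermitianZdCurved

open B7Prop1Explicit (Wcx boxVec bavg e treeWord U1)
open B7Prop2Explicit (unitaryUnits mem_unitaryUnits star_mlog_eq_neg bavg_mem_unitaryUnits hol_mem_of avgIter pdev C0 c2' C0_pos
  avgClosed_unitaryUnits avgIter_mem unitaryUnits_le_U1)
open B7Prop3Flat (expCfg)
open B7Eq92Concrete (tild wframe dbavgCov tHol dbavgCov_apply tild_apply Rc Rc_apply)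
open B7Prop3GeneralLinear (Qcov linQcov dbavgCov_one_right)
open B7Prop3GeneralRotated (expCfg_zero expCfg_zero_smul_mul tHol_expCfg_zero_smul hasDerivAt_tHol_expCfg)
open B7Prop3GeneralTild (hasDerivAt_Qcov hasDerivAt_Wcx_expCfg hasDerivAt_tild_expCfg linQcov_add linQcov_smul)
open B7Prop4GeneralLevels (linCovIter linCovIter_succ)
open B7Prop5GeneralLevels (level_loops)
open B7Prop8PrintedConstants (Rc_mem_unitaryUnits)
open B8Prop7AdmittedFamily (tHol_mem_unitaryUnits wframe_mem_unitaryUnits)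
open B7Eq78Linearization (conjR conjR_apply hasDerivAt_conjR_comp)
open B7Prop1Local (InBox AgreeOn loK bondHiK clampCfg clampCfg_agree clampCfg_mem pdev_clampCfg_le)
open B7Prop5Flat (bump)
open B8Ineq132 (plaqF pdevOn_lt_of_forall PlaqTouches BondTouches)
open B8Eq146AExpansion (iEta)
open B8LeafModelZd (ZdIdx)
open B9Eq316AveragingTransposeZd (tauForm entryT linCovIterT clsField wQ Reg17 alphaQ alphaQ_pos C0_mul_alphaQ_le four_mul_alphaQ_le reg17_one
  reg17_mono winBase)
open B9Eq316AveragingTransposeZdLinear (entryT_smul linCovIter_add_of_reg17 linCovIter_smul_of_reg17 linCovIterT_add linCovIterT_smul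
  clsField_add_of_reg17 clsField_smul_of_reg17)
open B9Eq316AveragingTransposeZdPrinted (QQZdP withQQP QQZdP_of_reg17 QQZdP_of_not_reg17 reg17_shift)
open B9Eq326DeltaAHermitianZd (isSelfAdjoint_entryT bump_add bump_smul star_bump isSelfAdjoint_deltaAOf_opsAllZd_of_QQ)
open B9Eq327GreenZd (domSub LinearOnDomAt)
open B9Eq327GreenZdHerm (domSubH HermPreservingAt)
open B9SupplySockB9P3ZdLetters (OpsZd deltaAOf)
open B9SupplySockB9P3ZdGenuineGop (QQLinearAt linearOnDomAt_opsGenuine)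
open B9SupplySockB9P3ZdAllLettersZd (opsAllZd)
open MatrixLog (mlog)

-- `Site` alone could resolve to the torus sites of `Setup.lean`; re-export the `ℤ^d` sites of `B7Prop1Explicit`.
export B7Prop1Explicit (Site)

variable {d : ℕ} {𝔸 : Type*} [CStarAlgebra 𝔸]

/-! ## §1 [5] Prop. 3 at a unitary background: the linear part «L(Q(V₀)A)_c» of (122) is REAL -/

section Reality

variable (L : ℕ)

/-- for real `s` and a skew-Hermitian-valued `B`, the configuration `e^{sB}` (109) is unitary-valued (exponential of a skew-adjoint element).
[cite: Balaban1985Averaging, (109) p.34, (22)–(23) p.21] -/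
theorem expCfg_real_smul_mem_unitaryUnits {B : Site d → Fin d → 𝔸} (hB : ∀ x κ, star (B x κ) = -B x κ) (s : ℝ)
    (x : Site d) (κ : Fin d) : expCfg ((s : ℂ) • B) x κ ∈ unitaryUnits 𝔸 := by
  have hmem : ((s : ℂ) • B) x κ ∈ skewAdjoint 𝔸 := by
    rw [Pi.smul_apply, Pi.smul_apply, Complex.coe_smul]
    exact skewAdjoint.smul_mem s ((skewAdjoint.mem_iff).2 (hB x κ))
  letI : NormedAlgebra ℚ 𝔸 := NormedAlgebra.restrictScalars ℚ ℂ 𝔸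
  rw [mem_unitaryUnits]
  show exp (((s : ℂ) • B) x κ) ∈ unitary 𝔸
  exact NormedSpace.exp_mem_unitary_of_mem_skewAdjoint hmem

/-- **THE DOUBLE-BAR AVERAGE (89) OF A UNITARY CONFIGURATION AT A UNITARY BACKGROUND IS UNITARY** when the block frames' twisted transports are within
`1∕4` of `1` at `c₋` and `c₊` and the block loops of `V₀` and of `V₁V₀` at `c` are within `1∕4` of `1` (`wframe ∕ bavg ∕ Rc` unitarity BY NAME).
[cite: Balaban1985Averaging, (89) p.31, (82) p.30, (65) p.29, (42) p.23, (22)–(23) p.21] -/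
theorem dbavgCov_mem_unitaryUnits {V₀ V₁ : Site d → Fin d → 𝔸ˣ} (hV₀ : ∀ x κ, V₀ x κ ∈ unitaryUnits 𝔸)
    (hV₁ : ∀ x κ, V₁ x κ ∈ unitaryUnits 𝔸) (q : Site d) (κ : Fin d)
    (hfrm : ∀ r : Fin d → Fin L, ‖((tHol V₀ V₁ q (treeWord (boxVec L r)) : 𝔸ˣ) : 𝔸) - 1‖ ≤ 1 / 4)
    (hfrp : ∀ r : Fin d → Fin L, ‖((tHol V₀ V₁ (q + (L : ℤ) • e κ) (treeWord (boxVec L r)) : 𝔸ˣ) : 𝔸) - 1‖ ≤ 1 / 4)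
    (hW₀ : ∀ r : Fin d → Fin L, ‖((Wcx L V₀ q κ (boxVec L r) : 𝔸ˣ) : 𝔸) - 1‖ ≤ 1 / 4)
    (hW₁ : ∀ r : Fin d → Fin L, ‖((Wcx L (V₁ * V₀) q κ (boxVec L r) : 𝔸ˣ) : 𝔸) - 1‖ ≤ 1 / 4) :
    dbavgCov L V₀ V₁ q κ ∈ unitaryUnits 𝔸 := by
  have hV₁V₀ : ∀ x μ, (V₁ * V₀) x μ ∈ unitaryUnits 𝔸 := fun x μ => by
    rw [Pi.mul_apply, Pi.mul_apply]
    exact (unitaryUnits 𝔸).mul_mem (hV₁ x μ) (hV₀ x μ)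
  have hb₀ : bavg L V₀ q κ ∈ unitaryUnits 𝔸 := bavg_mem_unitaryUnits hV₀ L q κ hW₀
  have hb₁ : bavg L (V₁ * V₀) q κ ∈ unitaryUnits 𝔸 := bavg_mem_unitaryUnits hV₁V₀ L q κ hW₁
  have htild : tild L V₀ V₁ q κ ∈ unitaryUnits 𝔸 := by
    rw [tild_apply]
    exact (unitaryUnits 𝔸).mul_mem hb₁ ((unitaryUnits 𝔸).inv_mem hb₀)
  rw [dbavgCov_apply]
  exact (unitaryUnits 𝔸).mul_mem
    ((unitaryUnits 𝔸).mul_mem ((unitaryUnits 𝔸).inv_mem (wframe_mem_unitaryUnits L hV₀ hV₁ q hfrm)) htild)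
    (Rc_mem_unitaryUnits hb₀ (wframe_mem_unitaryUnits L hV₀ hV₁ _ hfrp))

variable [Nontrivial 𝔸]

/-- **THE DOUBLE-BAR AVERAGE IS DIFFERENTIABLE ALONG `V₁ = e^{tA}` AT `t = 0`** (as an `𝔸`-valued function of `t ∈ ℂ`), under the disc condition
`‖W_x(V₀) − 1‖ < 1` on `B(c₋)` — the product of the three differentiable factors of (89) (frames (110), `Ṽ₁` (113)).
[cite: Balaban1985Averaging, (89) p.31, (120) p.35, (113) p.34] -/
theorem differentiableAt_dbavgCov_expCfg (V₀ : Site d → Fin d → 𝔸ˣ) (A : Site d → Fin d → 𝔸) (q : Site d) (κ : Fin d)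
    (hW : ∀ r : Fin d → Fin L, ‖((Wcx L V₀ q κ (boxVec L r) : 𝔸ˣ) : 𝔸) - 1‖ < 1) :
    DifferentiableAt ℂ (fun t : ℂ => ((dbavgCov L V₀ (expCfg (t • A)) q κ : 𝔸ˣ) : 𝔸)) 0 := by
  have h1 := B7Prop3GeneralLinear.hasDerivAt_wframe_inv_expCfg L V₀ A q
  have h2 := hasDerivAt_tild_expCfg L V₀ A q κ hW
  have h3 := hasDerivAt_conjR_comp (bavg L V₀ q κ) (B7Prop3GeneralLinear.hasDerivAt_wframe_expCfg L V₀ A (q + (L : ℤ) • e κ))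
  have h := (h1.fun_mul h2).fun_mul h3
  have hval : ∀ t : ℂ, ((dbavgCov L V₀ (expCfg (t • A)) q κ : 𝔸ˣ) : 𝔸)
      = (((wframe L V₀ (expCfg (t • A)) q)⁻¹ : 𝔸ˣ) : 𝔸) * ((tild L V₀ (expCfg (t • A)) q κ : 𝔸ˣ) : 𝔸)
          * conjR (bavg L V₀ q κ) ((wframe L V₀ (expCfg (t • A)) (q + (L : ℤ) • e κ) : 𝔸ˣ) : 𝔸) := by
    intro t
    rw [dbavgCov_apply, Units.val_mul, Units.val_mul, conjR_apply, Rc_apply, Units.val_mul, Units.val_mul]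
  simp_rw [hval]
  exact h.differentiableAt

omit [Nontrivial 𝔸] in
/-- a function `ℂ → 𝔸` continuous at `0` with value within distance `< δ` of `1` stays within `δ` for REAL parameters near `0`. [folklore] -/
private theorem eventually_norm_sub_one_real {g : ℂ → 𝔸} (hg : ContinuousAt g 0) {δ : ℝ} (h0 : ‖g 0 - 1‖ < δ) :
    ∀ᶠ s : ℝ in 𝓝 0, ‖g (s : ℂ) - 1‖ ≤ δ := by
  have hgR : ContinuousAt (fun s : ℝ => g (s : ℂ)) 0 := by
    have hc : ContinuousAt g ((0 : ℝ) : ℂ) := by rwa [Complex.ofReal_zero]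
    exact hc.comp Complex.continuous_ofReal.continuousAt
  have hmem : Metric.ball (1 : 𝔸) δ ∈ 𝓝 (g ((0 : ℝ) : ℂ)) := by
    rw [Complex.ofReal_zero]
    exact Metric.isOpen_ball.mem_nhds (by rwa [Metric.mem_ball, dist_eq_norm])
  filter_upwards [hgR.eventually_mem hmem] with s hs
  rw [Metric.mem_ball, dist_eq_norm] at hs
  exact hs.le

/-- ★★★ **THE LINEARISED COVARIANT AVERAGE IS REAL AT A UNITARY BACKGROUND**: for a unitary-valued `V₀` whose block loops at `c` satisfy
`‖W_x(V₀) − 1‖ < 1∕4` (`x ∈ B(c₋)`) and a skew-Hermitian-valued `B` (print's `iA`, `A` 𝔤-valued): the linear part «L(Q(V₀)B)_c» of (122) is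
skew-Hermitian, `(L(Q(V₀)B)_c)* = −L(Q(V₀)B)_c` — i.e. REAL in print's `(1∕i)`-convention («Q(V₀, A, c) = (1∕i) log(V̿₁)_c», the logarithm of a
unitary).  Proof: along `V₁ = e^{sB}`, `s ∈ ℝ` near `0`, `V̿₁(c)` (89) is unitary (frames (82), averages (42), rotations `R`, all unitary by
(22)–(23)) and within `1∕4` of `1` (continuity at `s = 0`, where `V̿₁ = 1`), so `Q(V₀, sB, c) = log V̿₁(c)` is skew-adjoint ((22)–(23));
differentiate at `s = 0` ((120): the derivative is «L(Q(V₀)B)_c», `B7Prop3GeneralTild.hasDerivAt_Qcov`) and use that the involution is real-linear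
and continuous. [cite: Balaban1985Averaging, (121)–(122) p.36, (120) p.35, (89) p.31, (22)–(23) p.21; Balaban1985BackgroundPropagators, (3.16) p.393, p.391] -/
theorem star_linQcov_of_skew {V₀ : Site d → Fin d → 𝔸ˣ} (hV₀ : ∀ x κ, V₀ x κ ∈ unitaryUnits 𝔸)
    {B : Site d → Fin d → 𝔸} (hB : ∀ x κ, star (B x κ) = -B x κ) (q : Site d) (κ : Fin d)
    (hW : ∀ r : Fin d → Fin L, ‖((Wcx L V₀ q κ (boxVec L r) : 𝔸ˣ) : 𝔸) - 1‖ < 1 / 4) :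
    star (linQcov L V₀ B q κ) = -linQcov L V₀ B q κ := by
  have hW1 : ∀ r : Fin d → Fin L, ‖((Wcx L V₀ q κ (boxVec L r) : 𝔸ˣ) : 𝔸) - 1‖ < 1 := fun r => (hW r).trans (by norm_num)
  -- (120): `t ↦ Q(V₀, tB, c)` has complex derivative «L(Q(V₀)B)_c» at `0`
  have hf : HasDerivAt (fun t : ℂ => Qcov L V₀ (t • B) q κ) (linQcov L V₀ B q κ) 0 :=
    (hasDerivAt_Qcov L V₀ B q κ hW1).differentiableAt.hasDerivAt
  -- restricted to the real line
  have hfR : HasDerivAt (fun s : ℝ => Qcov L V₀ ((s : ℂ) • B) q κ) (linQcov L V₀ B q κ) 0 := by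
    have h0 : HasDerivAt (fun t : ℂ => Qcov L V₀ (t • B) q κ) (linQcov L V₀ B q κ) (Complex.ofRealCLM (0 : ℝ)) := by
      rwa [Complex.ofRealCLM_apply, Complex.ofReal_zero]
    simpa only [Function.comp_def, Complex.ofRealCLM_apply, Complex.ofReal_one, one_smul] using
      h0.scomp (0 : ℝ) Complex.ofRealCLM.hasDerivAt
  -- the unit configuration `e^{sB}`, `s ∈ ℝ`, is unitary-valued
  have hV₁ : ∀ (s : ℝ) x μ, expCfg ((s : ℂ) • B) x μ ∈ unitaryUnits 𝔸 := fun s => expCfg_real_smul_mem_unitaryUnits hB s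
  -- eventually in `s`: the frames' twisted transports, the loops of `V₁V₀`, and `V̿₁` itself are within `1∕4` of `1`
  have hfr : ∀ (y : Site d) (r : Fin d → Fin L),
      ∀ᶠ s : ℝ in 𝓝 0, ‖((tHol V₀ (expCfg ((s : ℂ) • B)) y (treeWord (boxVec L r)) : 𝔸ˣ) : 𝔸) - 1‖ ≤ 1 / 4 := by
    intro y r
    refine eventually_norm_sub_one_real (g := fun t : ℂ => ((tHol V₀ (expCfg (t • B)) y (treeWord (boxVec L r)) : 𝔸ˣ) : 𝔸))
      (hasDerivAt_tHol_expCfg V₀ B y (treeWord (boxVec L r))).continuousAt ?_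
    show ‖((tHol V₀ (expCfg ((0 : ℂ) • B)) y (treeWord (boxVec L r)) : 𝔸ˣ) : 𝔸) - 1‖ < 1 / 4
    rw [tHol_expCfg_zero_smul, Units.val_one, sub_self, norm_zero]
    norm_num
  have hloop : ∀ r : Fin d → Fin L,
      ∀ᶠ s : ℝ in 𝓝 0, ‖((Wcx L (expCfg ((s : ℂ) • B) * V₀) q κ (boxVec L r) : 𝔸ˣ) : 𝔸) - 1‖ ≤ 1 / 4 := by
    intro r
    refine eventually_norm_sub_one_real (g := fun t : ℂ => ((Wcx L (expCfg (t • B) * V₀) q κ (boxVec L r) : 𝔸ˣ) : 𝔸))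
      (hasDerivAt_Wcx_expCfg L V₀ B q κ (boxVec L r)).continuousAt ?_
    show ‖((Wcx L (expCfg ((0 : ℂ) • B) * V₀) q κ (boxVec L r) : 𝔸ˣ) : 𝔸) - 1‖ < 1 / 4
    rw [expCfg_zero_smul_mul]
    exact hW r
  have hdb : ∀ᶠ s : ℝ in 𝓝 0, ‖((dbavgCov L V₀ (expCfg ((s : ℂ) • B)) q κ : 𝔸ˣ) : 𝔸) - 1‖ ≤ 1 / 4 := by
    refine eventually_norm_sub_one_real (g := fun t : ℂ => ((dbavgCov L V₀ (expCfg (t • B)) q κ : 𝔸ˣ) : 𝔸))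
      (differentiableAt_dbavgCov_expCfg L V₀ B q κ hW1).continuousAt ?_
    show ‖((dbavgCov L V₀ (expCfg ((0 : ℂ) • B)) q κ : 𝔸ˣ) : 𝔸) - 1‖ < 1 / 4
    rw [zero_smul, expCfg_zero, dbavgCov_one_right, Units.val_one, sub_self, norm_zero]
    norm_num
  -- hence eventually `Q(V₀, sB, c)` is skew-adjoint
  have hev : ∀ᶠ s : ℝ in 𝓝 0, -Qcov L V₀ ((s : ℂ) • B) q κ = star (Qcov L V₀ ((s : ℂ) • B) q κ) := by
    have hW₀ : ∀ r : Fin d → Fin L, ‖((Wcx L V₀ q κ (boxVec L r) : 𝔸ˣ) : 𝔸) - 1‖ ≤ 1 / 4 := fun r => (hW r).le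
    filter_upwards [(eventually_all).2 (hfr q), (eventually_all).2 (hfr (q + (L : ℤ) • e κ)), (eventually_all).2 hloop, hdb]
      with s hm hp hl hd
    have hu := dbavgCov_mem_unitaryUnits L hV₀ (hV₁ s) q κ hm hp hW₀ hl
    rw [Qcov, star_mlog_eq_neg ((mem_unitaryUnits).1 hu) hd]
  -- differentiate `star ∘ Q = −Q` at `s = 0`
  exact (hfR.star.congr_of_eventuallyEq hev).unique hfR.neg

omit [Nontrivial 𝔸] in
/-- the decomposition of an element into two skew-Hermitian parts: `X = ½(X − X*) + i·(−i∕2)(X + X*)`. [folklore] -/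
private theorem skew_decomposition (X : 𝔸) :
    X = (2⁻¹ : ℂ) • (X - star X) + Complex.I • ((-Complex.I * 2⁻¹ : ℂ) • (X + star X)) := by
  rw [smul_smul, ← mul_assoc, mul_neg, Complex.I_mul_I, neg_neg, one_mul, smul_sub, smul_add]
  have h2 : (2⁻¹ : ℂ) • X + (2⁻¹ : ℂ) • X = X := by
    rw [← add_smul]; norm_num
  calc X = (2⁻¹ : ℂ) • X + (2⁻¹ : ℂ) • X := h2.symm
    _ = (2⁻¹ : ℂ) • X - (2⁻¹ : ℂ) • star X + ((2⁻¹ : ℂ) • X + (2⁻¹ : ℂ) • star X) := by abel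

/-- ★ **THE LINEARISED COVARIANT AVERAGE COMMUTES WITH THE INVOLUTION** at a unitary background with block loops within `1∕4` of `1`: for EVERY bond
field `B`, `L(Q(V₀)B*)_c = (L(Q(V₀)B)_c)*` — reality on skew fields (`star_linQcov_of_skew`) plus `ℂ`-linearity (`linQcov_add ∕ _smul`), through the
decomposition `B = ½(B − B*) + i·(−i∕2)(B + B*)` into skew-Hermitian parts. [cite: Balaban1985Averaging, (121)–(122) p.36, (22)–(23) p.21; Balaban1985BackgroundPropagators, (3.16) p.393] -/
theorem linQcov_star {V₀ : Site d → Fin d → 𝔸ˣ} (hV₀ : ∀ x κ, V₀ x κ ∈ unitaryUnits 𝔸) (B : Site d → Fin d → 𝔸)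
    (q : Site d) (κ : Fin d) (hW : ∀ r : Fin d → Fin L, ‖((Wcx L V₀ q κ (boxVec L r) : 𝔸ˣ) : 𝔸) - 1‖ < 1 / 4) :
    linQcov L V₀ (star B) q κ = star (linQcov L V₀ B q κ) := by
  have hW1 : ∀ r : Fin d → Fin L, ‖((Wcx L V₀ q κ (boxVec L r) : 𝔸ˣ) : 𝔸) - 1‖ < 1 := fun r => (hW r).trans (by norm_num)
  -- the two skew-Hermitian parts of `B`
  set K₁ : Site d → Fin d → 𝔸 := (2⁻¹ : ℂ) • (B - star B) with hK₁
  set K₂ : Site d → Fin d → 𝔸 := (-Complex.I * 2⁻¹ : ℂ) • (B + star B) with hK₂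
  have hc₁ : star ((2⁻¹ : ℂ)) = 2⁻¹ := by rw [Complex.star_def, map_inv₀, map_ofNat]
  have hc₂ : star ((-Complex.I * 2⁻¹ : ℂ)) = -(-Complex.I * 2⁻¹) := by
    rw [Complex.star_def, map_mul, map_neg, Complex.conj_I, map_inv₀, map_ofNat]; ring
  have hK₁s : ∀ x μ, star (K₁ x μ) = -K₁ x μ := fun x μ => by
    simp only [hK₁, Pi.smul_apply, Pi.sub_apply, Pi.star_apply]
    rw [star_smul, star_sub, star_star, hc₁, ← smul_neg, neg_sub]
  have hK₂s : ∀ x μ, star (K₂ x μ) = -K₂ x μ := fun x μ => by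
    simp only [hK₂, Pi.smul_apply, Pi.add_apply, Pi.star_apply]
    rw [star_smul, star_add, star_star, add_comm (star (B x μ)), hc₂, neg_smul]
  have hBdec : ∀ x μ, B x μ = (K₁ + Complex.I • K₂) x μ := fun x μ => by
    simp only [hK₁, hK₂, Pi.add_apply, Pi.smul_apply, Pi.sub_apply, Pi.star_apply]
    exact skew_decomposition (B x μ)
  have hBeq : B = K₁ + Complex.I • K₂ := funext fun x => funext fun μ => hBdec x μ
  have hBseq : star B = (-1 : ℂ) • K₁ + Complex.I • K₂ := by
    funext x μ
    rw [Pi.star_apply, Pi.star_apply, hBdec x μ]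
    simp only [Pi.add_apply, Pi.smul_apply, Pi.neg_apply, star_add, star_smul, Complex.star_def, Complex.conj_I, hK₁s, hK₂s, neg_smul,
      smul_neg, neg_neg, one_smul]
  have h1 := star_linQcov_of_skew L hV₀ hK₁s q κ hW
  have h2 := star_linQcov_of_skew L hV₀ hK₂s q κ hW
  have lhs : linQcov L V₀ (star B) q κ = -linQcov L V₀ K₁ q κ + Complex.I • linQcov L V₀ K₂ q κ := by
    rw [hBseq, linQcov_add L V₀ ((-1 : ℂ) • K₁) (Complex.I • K₂) q κ hW1, linQcov_smul L V₀ (-1) K₁ q κ hW1,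
      linQcov_smul L V₀ Complex.I K₂ q κ hW1, neg_one_smul]
  have rhs : linQcov L V₀ B q κ = linQcov L V₀ K₁ q κ + Complex.I • linQcov L V₀ K₂ q κ := by
    conv_lhs => rw [hBeq]
    rw [linQcov_add L V₀ K₁ (Complex.I • K₂) q κ hW1, linQcov_smul L V₀ Complex.I K₂ q κ hW1]
  rw [lhs, rhs, star_add, star_smul, h1, h2, Complex.star_def, Complex.conj_I, neg_smul, smul_neg, neg_neg]

end Reality

/-! ## §2 The composite `LʲηQ_j(U₀)` ([5] (127)) commutes with the involution at a globally regular unitary background -/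

section Levels

variable [Nontrivial 𝔸]

/-- **AT EVERY LEVEL BACKGROUND `Ū₀ʲ` THE ONE-STEP LINEAR PART COMMUTES WITH THE INVOLUTION** (unitary-valued `U₀` with `|U₀(∂p) − 1| < α₀L^{−2k}` in the
Prop.-2 window: every `Ū₀ʲ`, `j ≤ k`, is unitary-valued (`avgIter_mem`) with block loops within `1∕64` of `1` (`level_loops`), so `linQcov_star` applies).
[cite: Balaban1985Averaging, p.37 (after (127)), Prop. 2 (52)–(54) p.26, (122) p.36] -/
theorem hstar_levels (L : ℕ) (hL : 2 ≤ L) (k : ℕ) (U₀ : Site d → Fin d → 𝔸ˣ) (hU₀ : ∀ x κ, U₀ x κ ∈ unitaryUnits 𝔸) {α₀ : ℝ} (hα : 0 < α₀)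
    (hα3 : C0 d * α₀ ≤ 1 / 3) (hα4 : 4 * α₀ ≤ c2' d L) (h52 : pdev U₀ < α₀ * (((L : ℝ) ^ k)⁻¹) ^ 2) :
    ∀ j < k, ∀ (F : Site d → Fin d → 𝔸) (z : Site d) (κ : Fin d),
      linQcov L (avgIter L U₀ j) (star F) ((L : ℤ) • z) κ = star (linQcov L (avgIter L U₀ j) F ((L : ℤ) • z) κ) := by
  intro j hj F z κ
  have hV : ∀ x μ, avgIter L U₀ j x μ ∈ unitaryUnits 𝔸 :=
    avgIter_mem L hL (avgClosed_unitaryUnits d L) k U₀ hU₀ hα hα3 (by linarith) h52 j hj.le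
  obtain ⟨hloop, hsmall⟩ := level_loops L hL (avgClosed_unitaryUnits d L) k U₀ hU₀ hα hα3 hα4 h52 j hj.le ((L : ℤ) • z) κ
  exact linQcov_star L hV F _ κ fun r => ((hloop r).trans hsmall).trans_lt (by norm_num)

omit [Nontrivial 𝔸] in
/-- **THE COMPOSITE (127) COMMUTES WITH THE INVOLUTION** given that every one-step factor does (levels `< k`): `LʲηQ_j(U₀)(B*) = (LʲηQ_j(U₀)B)*`, `j ≤ k`,
for ALL bond fields `B` (induction on «Q_{j+1}(U₀) = Q(Ū₀ʲ)Q_j(U₀)»). [cite: Balaban1985Averaging, (127) p.37, p.38 (before (133))] -/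
theorem linCovIter_star_of_levels (L : ℕ) {k : ℕ} {U₀ : Site d → Fin d → 𝔸ˣ}
    (hstar : ∀ j < k, ∀ (F : Site d → Fin d → 𝔸) (z : Site d) (κ : Fin d),
      linQcov L (avgIter L U₀ j) (star F) ((L : ℤ) • z) κ = star (linQcov L (avgIter L U₀ j) F ((L : ℤ) • z) κ)) :
    ∀ j ≤ k, ∀ (B : Site d → Fin d → 𝔸) (z : Site d) (κ : Fin d), linCovIter L U₀ (star B) j z κ = star (linCovIter L U₀ B j z κ)
  | 0, _, _, _, _ => rfl
  | j + 1, hj, B, z, κ => by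
    have ih : linCovIter L U₀ (star B) j = star (linCovIter L U₀ B j) :=
      funext fun z' => funext fun κ' => linCovIter_star_of_levels L hstar j (Nat.le_of_succ_le hj) B z' κ'
    rw [linCovIter_succ, linCovIter_succ, ih, hstar j hj]

/-- ★ **`LʲηQ_j(U₀)` COMMUTES WITH THE INVOLUTION AT A GLOBALLY REGULAR UNITARY BACKGROUND**, `j ≤ k`, all fields.
[cite: Balaban1985Averaging, (127) p.37, (122) p.36, Prop. 2 (52)–(54) p.26] -/
theorem linCovIter_star_of_pdev (L : ℕ) (hL : 2 ≤ L) (k : ℕ) (U₀ : Site d → Fin d → 𝔸ˣ) (hU₀ : ∀ x κ, U₀ x κ ∈ unitaryUnits 𝔸) {α₀ : ℝ}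
    (hα : 0 < α₀) (hα3 : C0 d * α₀ ≤ 1 / 3) (hα4 : 4 * α₀ ≤ c2' d L) (h52 : pdev U₀ < α₀ * (((L : ℝ) ^ k)⁻¹) ^ 2)
    {j : ℕ} (hj : j ≤ k) (B : Site d → Fin d → 𝔸) (z : Site d) (κ : Fin d) :
    linCovIter L U₀ (star B) j z κ = star (linCovIter L U₀ B j z κ) :=
  linCovIter_star_of_levels L (hstar_levels L hL k U₀ hU₀ hα hα3 hα4 h52) j hj B z κ

end Levels

/-! ## §3 At a class bond of print's class (1.7): the composite commutes with the involution (clamping + locality) -/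

section Regime

variable [Nontrivial 𝔸]

omit [CStarAlgebra 𝔸] [Nontrivial 𝔸] in
/-- the box is a genuine box (private copy of the lineage's lemma). [cite: Balaban1985Averaging, p.24 (the boxes B^k(c₋) ∪ B^k(c₊))] -/
private theorem loK_le_bondHiK {L : ℕ} (hL : 1 ≤ L) (j : ℕ) (z : Site d) (κ : Fin d) (i : Fin d) :
    loK L j z i ≤ bondHiK L j z κ i := by
  have hP : (1 : ℤ) ≤ (L : ℤ) ^ j := one_le_pow₀ (by exact_mod_cast hL)
  simp only [loK, bondHiK]
  split_ifs <;> omega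

/-- the clamped extension of a class-(1.7) background at a bond whose box lies in `Ω_j` (private copy of dag-n06-b's `clamp_data`): unitary-valued,
globally regular at level `j`, and equal to `U₀` on the box. [cite: Balaban1985Averaging, p.24 (locality), Prop. 1 (51) p.26; Balaban1985RegularSpaces, (1.7) p.77] -/
private theorem clamp_data {L : ℕ} (hL : 1 ≤ L) {m : ℕ} {Ω : ℕ → Set (Site d)} {α : ℝ} (hα : 0 < α)
    {U₀ : Site d → Fin d → 𝔸ˣ} (hU₀ : ∀ x κ, U₀ x κ ∈ unitaryUnits 𝔸) (hreg : Reg17 L m Ω α U₀)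
    {j : ℕ} (hj : j ≤ m) (z : Site d) (κ : Fin d) (hbox : ∀ x, InBox (loK L j z) (bondHiK L j z κ) x → x ∈ Ω j) :
    (∀ x ν, clampCfg (loK L j z) (bondHiK L j z κ) U₀ x ν ∈ unitaryUnits 𝔸) ∧
      pdev (clampCfg (loK L j z) (bondHiK L j z κ) U₀) < α * (((L : ℝ) ^ j)⁻¹) ^ 2 ∧
      AgreeOn (loK L j z) (bondHiK L j z κ) (clampCfg (loK L j z) (bondHiK L j z κ) U₀) U₀ := by
  have hU₀U1 : ∀ x μ, U₀ x μ ∈ U1 𝔸 := fun x μ => (avgClosed_unitaryUnits d L).le_U1 (hU₀ x μ)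
  have hL0 : (0 : ℝ) < L := by exact_mod_cast hL
  refine ⟨clampCfg_mem hU₀, ?_, clampCfg_agree U₀⟩
  have hpdOn : B7Prop1Local.pdevOn (loK L j z) (bondHiK L j z κ) U₀ < α * (((L : ℝ) ^ j)⁻¹) ^ 2 := by
    refine pdevOn_lt_of_forall (by positivity) fun x μ ν hx hx' => ?_
    rcases eq_or_ne μ ν with rfl | hμν
    · rw [B7Prop2Explicit.hol_plaqWord_self, Units.val_one, sub_self, norm_zero]; positivity
    · exact hreg j hj x μ ν hμν (Or.inl (hbox x hx))
  exact (pdev_clampCfg_le (loK_le_bondHiK hL j z κ) hU₀U1).trans_lt hpdOn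

/-- ★ **[5] (122)∕(127) AT A CLASS BOND — THE COMPOSITE COMMUTES WITH THE INVOLUTION**: for a unitary `U₀` in the class (1.7) up to level `m`
(`α ≤ α_Q`), a level-`j` bond (`j ≤ m`) whose box lies in `Ω_j`, and ALL bond fields `B`: `LʲηQ_j(U₀)(B*)(c) = (LʲηQ_j(U₀)B(c))*` — §2 at the
clamped extension (globally regular, unitary), transported by locality (`B9Ineq3137LocalSup.linCovIter_congr`). [cite: Balaban1985Averaging, (122) p.36, (127) p.37, p.24; Balaban1985RegularSpaces, (1.7) p.77] -/
theorem linCovIter_star_of_reg17 {L : ℕ} (hL : 2 ≤ L) {m : ℕ} {Ω : ℕ → Set (Site d)} {α : ℝ} (hα : 0 < α)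
    (hαQ : α ≤ alphaQ d L) {U₀ : Site d → Fin d → 𝔸ˣ} (hU₀ : ∀ x κ, U₀ x κ ∈ unitaryUnits 𝔸) (hreg : Reg17 L m Ω α U₀)
    {j : ℕ} (hj : j ≤ m) (z : Site d) (κ : Fin d) (hbox : ∀ x, InBox (loK L j z) (bondHiK L j z κ) x → x ∈ Ω j)
    (B : Site d → Fin d → 𝔸) :
    linCovIter L U₀ (star B) j z κ = star (linCovIter L U₀ B j z κ) := by
  have hL1 : 1 ≤ L := le_trans (by norm_num) hL
  obtain ⟨hUG, hpdev, hag⟩ := clamp_data hL1 hα hU₀ hreg hj z κ hbox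
  have hα3 : C0 d * α ≤ 1 / 3 := (mul_le_mul_of_nonneg_left hαQ (C0_pos d).le).trans (C0_mul_alphaQ_le d L)
  have hα4 : 4 * α ≤ c2' d L := by linarith [four_mul_alphaQ_le d L]
  set U' := clampCfg (loK L j z) (bondHiK L j z κ) U₀ with hU'
  have htr : ∀ F : Site d → Fin d → 𝔸, linCovIter L U₀ F j z κ = linCovIter L U' F j z κ :=
    fun F => B9Ineq3137LocalSup.linCovIter_congr L hL1 j z κ hag.symm (fun _ _ _ _ => rfl)
  rw [htr, htr B]
  exact linCovIter_star_of_pdev L hL j U' hUG hα hα3 hα4 hpdev le_rfl B z κ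

/-- **THE COMPOSITE OF A SKEW-HERMITIAN FIELD IS SKEW-HERMITIAN AT A CLASS BOND** (same hypotheses): `(LʲηQ_j(U₀)B(c))* = −LʲηQ_j(U₀)B(c)` for
`B* = −B`. [cite: Balaban1985Averaging, (122) p.36, (127) p.37; Balaban1985BackgroundPropagators, (3.16) p.393] -/
theorem star_linCovIter_of_reg17_of_skew {L : ℕ} (hL : 2 ≤ L) {m : ℕ} {Ω : ℕ → Set (Site d)} {α : ℝ} (hα : 0 < α)
    (hαQ : α ≤ alphaQ d L) {U₀ : Site d → Fin d → 𝔸ˣ} (hU₀ : ∀ x κ, U₀ x κ ∈ unitaryUnits 𝔸) (hreg : Reg17 L m Ω α U₀)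
    {j : ℕ} (hj : j ≤ m) (z : Site d) (κ : Fin d) (hbox : ∀ x, InBox (loK L j z) (bondHiK L j z κ) x → x ∈ Ω j)
    {B : Site d → Fin d → 𝔸} (hB : ∀ x μ, star (B x μ) = -B x μ) :
    star (linCovIter L U₀ B j z κ) = -linCovIter L U₀ B j z κ := by
  have hsB : star B = (-1 : ℂ) • B := by
    funext x μ
    rw [Pi.star_apply, Pi.star_apply, hB, Pi.smul_apply, Pi.smul_apply, neg_one_smul]
  rw [← linCovIter_star_of_reg17 hL hα hαQ hU₀ hreg hj z κ hbox B, hsB, linCovIter_smul_of_reg17 hL hα hαQ hU₀ hreg hj z κ hbox,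
    neg_one_smul]

end Regime

/-! ## §4 The transposed averaging, the class field and the letter `Q*aQ` send Hermitian fields to Hermitian fields on the class (1.7) -/

section Letter

variable (τ : 𝔸 →ₗ[ℂ] ℂ) [FiniteDimensional ℝ 𝔸] [Nontrivial 𝔸] {L : ℕ}

omit [Nontrivial 𝔸] in
/-- `Eᵀ0 = 0` (from real-homogeneity of the transpose in its vector argument). [cite: Balaban1985BackgroundPropagators, (3.16) p.393 («an operator Q*aQ»)] -/
private theorem entryT_zero (E : 𝔸 → 𝔸) : entryT τ E 0 = 0 := by
  have h := entryT_smul τ E (0 : ℝ) (0 : 𝔸)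
  rwa [zero_smul, zero_smul] at h

omit [Nontrivial 𝔸] in
/-- **AT LEVEL `0` THE TRANSPOSE IS THE TRANSPOSE OF THE IDENTITY**: `Q₀ = 1` ([5] (127) «Q₀(U₀, ηA) = ηA»), so `Q₀ᵀB` of a Hermitian-valued `B` is
Hermitian-valued at EVERY background — no box, no regularity (dag-n06-b g19's LOCATED-SELF-5: the level-0 box clause is spurious).
[cite: Balaban1985Averaging, (127) p.37; Balaban1985BackgroundPropagators, (3.16) p.393, p.391] -/
theorem isSelfAdjoint_linCovIterT_zero (hτp : ∀ a : 𝔸, a ≠ 0 → 0 < (τ (star a * a)).re)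
    (hτt : ∀ a b : 𝔸, τ (a * b) = τ (b * a)) (hτs : ∀ a : 𝔸, τ (star a) = starRingEnd ℂ (τ a))
    (U₀ : Site d → Fin d → 𝔸ˣ) {B : Site d → Fin d → 𝔸} (hB : ∀ w κ, IsSelfAdjoint (B w κ)) (y : Site d) (μ : Fin d) :
    IsSelfAdjoint (linCovIterT τ L U₀ 0 B y μ) := by
  unfold linCovIterT
  refine isSelfAdjoint_sum _ fun κ _ => isSelfAdjoint_sum _ fun t _ => ?_
  simp only [B7Prop4GeneralLevels.linCovIter_zero]
  refine isSelfAdjoint_entryT τ hτp hτt hτs (fun X Y => ?_) (fun c X => ?_) (fun X => ?_) (hB _ κ)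
  · rw [bump_add, Pi.add_apply, Pi.add_apply]
  · rw [bump_smul, Pi.smul_apply, Pi.smul_apply]
  · rw [← star_bump, Pi.star_apply, Pi.star_apply]

/-- ★ **THE TRANSPOSED AVERAGING `Q_jᵀB` OF A HERMITIAN-VALUED `B` IS HERMITIAN-VALUED ON THE CLASS (1.7)** (faithful Hermitian tracial `τ`, unitary `U₀ ∈ 𝔄`
up to level `m` at window `α ≤ α_Q`, `j ≤ m`, and — for `j ≥ 1` only, level `0` being the identity — the box of every level-`j` bond CARRYING `B` inside
`Ω_j`): each entry is the τ-transpose of the column `X ↦ LʲηQ_j(U₀)(X·δ_b)(c)` — additive, real-homogeneous ([5] (122) at the class bond) and star-compatible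
(§3) — applied to a Hermitian value (`isSelfAdjoint_entryT`); columns at bonds where `B = 0` contribute `0`. [cite: Balaban1985BackgroundPropagators, (3.16) p.393, p.391; Balaban1985Averaging, (127) p.37, (147) p.40] -/
theorem isSelfAdjoint_linCovIterT_of_reg17 (hL : 2 ≤ L) (hτp : ∀ a : 𝔸, a ≠ 0 → 0 < (τ (star a * a)).re)
    (hτt : ∀ a b : 𝔸, τ (a * b) = τ (b * a)) (hτs : ∀ a : 𝔸, τ (star a) = starRingEnd ℂ (τ a))
    {m : ℕ} {Ω : ℕ → Set (Site d)} {α : ℝ} (hα : 0 < α) (hαQ : α ≤ alphaQ d L)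
    {U₀ : Site d → Fin d → 𝔸ˣ} (hU₀ : ∀ x κ, U₀ x κ ∈ unitaryUnits 𝔸) (hreg : Reg17 L m Ω α U₀) {j : ℕ} (hj : j ≤ m)
    {B : Site d → Fin d → 𝔸} (hB : ∀ w κ, IsSelfAdjoint (B w κ))
    (hBbox : 1 ≤ j → ∀ w κ, B w κ ≠ 0 → ∀ x, InBox (loK L j w) (bondHiK L j w κ) x → x ∈ Ω j) (y : Site d) (μ : Fin d) :
    IsSelfAdjoint (linCovIterT τ L U₀ j B y μ) := by
  rcases Nat.eq_zero_or_pos j with rfl | hjpos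
  · exact isSelfAdjoint_linCovIterT_zero τ hτp hτt hτs U₀ hB y μ
  unfold linCovIterT
  refine isSelfAdjoint_sum _ fun κ _ => isSelfAdjoint_sum _ fun t _ => ?_
  by_cases hz : B (winBase L j y κ t) κ = 0
  · rw [hz, entryT_zero]
    exact IsSelfAdjoint.zero _
  · have hbox := hBbox hjpos _ _ hz
    refine isSelfAdjoint_entryT τ hτp hτt hτs (fun X Y => ?_) (fun c X => ?_) (fun X => ?_) (hB _ κ)
    · rw [bump_add, linCovIter_add_of_reg17 hL hα hαQ hU₀ hreg hj _ κ hbox]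
    · have h1 : (c • bump y μ X : Site d → Fin d → 𝔸) = (c : ℂ) • bump y μ X := by
        funext x ν; simp only [Pi.smul_apply, Complex.coe_smul]
      rw [bump_smul, h1, linCovIter_smul_of_reg17 hL hα hαQ hU₀ hreg hj _ κ hbox, Complex.coe_smul]
    · rw [← star_bump, linCovIter_star_of_reg17 hL hα hαQ hU₀ hreg hj _ κ hbox]

omit [FiniteDimensional ℝ 𝔸] [Nontrivial 𝔸] in
/-- `iηA` is skew-Hermitian-valued for a Hermitian-valued `A`. [cite: Balaban1985RegularSpaces, (1.41) p.83 (the exponent variable `iηA`, `A` 𝔤-valued)] -/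
theorem star_iEta_of_isSelfAdjoint (η : ℝ) {A : Site d → Fin d → 𝔸} (hA : ∀ w κ, IsSelfAdjoint (A w κ)) (w : Site d) (κ : Fin d) :
    star (iEta η A w κ) = -iEta η A w κ := by
  rw [B8Eq146AExpansion.iEta_def]
  simp only [star_smul, (hA w κ).star_eq, Complex.star_def, map_mul, Complex.conj_I, Complex.conj_ofReal, neg_mul, neg_smul]

omit [FiniteDimensional ℝ 𝔸] [Nontrivial 𝔸] in
/-- **AT LEVEL `0` THE CLASS FIELD IS `𝟙_{Λ_0}·ηA`** (`Q₀ = 1`): Hermitian-valued for Hermitian `A` at EVERY background — no box, no regularity.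
[cite: Balaban1985Averaging, (127) p.37; Balaban1985BackgroundPropagators, (3.16) p.393] -/
theorem isSelfAdjoint_clsField_zero (ΛbP : ℕ → ℕ → Set (Site d × Fin d)) (η : ℝ) (m : ℕ) (U₀ : Site d → Fin d → 𝔸ˣ)
    {A : Site d → Fin d → 𝔸} (hA : ∀ w κ, IsSelfAdjoint (A w κ)) (z : Site d) (κ : Fin d) :
    IsSelfAdjoint (clsField L ΛbP η m 0 U₀ A z κ) := by
  classical
  unfold clsField
  split_ifs
  · rw [B7Prop4GeneralLevels.linCovIter_zero, IsSelfAdjoint, star_smul, star_iEta_of_isSelfAdjoint η hA, Complex.star_def, map_neg,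
      Complex.conj_I, neg_neg, smul_neg, ← neg_smul]
  · exact IsSelfAdjoint.zero _

omit [FiniteDimensional ℝ 𝔸] in
/-- ★ **THE CLASS FIELD `𝟙_{Λ_j}·(−i)LʲηQ_j(U₀)(iηA)` OF A HERMITIAN `A` IS HERMITIAN-VALUED ON THE CLASS (1.7)** when — for `j ≥ 1` — every box of a level-`j`
class bond lies in `Ω_j`: `iηA` is skew, so is its composite average (§3), and `(−i)·(skew)` is Hermitian; at `j = 0` unconditionally (`isSelfAdjoint_clsField_zero`).
[cite: Balaban1985BackgroundPropagators, (3.16) p.393; Balaban1985RegularSpaces, (1.56), (1.58) p.86; Balaban1985Averaging, (127) p.37] -/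
theorem isSelfAdjoint_clsField_of_reg17 (hL : 2 ≤ L) {m : ℕ} {Ω : ℕ → Set (Site d)} {α : ℝ} (hα : 0 < α) (hαQ : α ≤ alphaQ d L)
    {U₀ : Site d → Fin d → 𝔸ˣ} (hU₀ : ∀ x κ, U₀ x κ ∈ unitaryUnits 𝔸) (hreg : Reg17 L m Ω α U₀)
    (ΛbP : ℕ → ℕ → Set (Site d × Fin d)) {j : ℕ} (hj : j ≤ m)
    (hbox : 1 ≤ j → ∀ c ∈ ΛbP m j, ∀ x, InBox (loK L j c.1) (bondHiK L j c.1 c.2) x → x ∈ Ω j)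
    (η : ℝ) {A : Site d → Fin d → 𝔸} (hA : ∀ w κ, IsSelfAdjoint (A w κ)) (z : Site d) (κ : Fin d) :
    IsSelfAdjoint (clsField L ΛbP η m j U₀ A z κ) := by
  classical
  rcases Nat.eq_zero_or_pos j with rfl | hjpos
  · exact isSelfAdjoint_clsField_zero ΛbP η m U₀ hA z κ
  unfold clsField
  split_ifs with hc
  · have hsk := star_linCovIter_of_reg17_of_skew hL hα hαQ hU₀ hreg hj z κ (hbox hjpos (z, κ) hc) (star_iEta_of_isSelfAdjoint η hA)
    rw [IsSelfAdjoint, star_smul, hsk, Complex.star_def, map_neg, Complex.conj_I, neg_neg, smul_neg, ← neg_smul]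
  · exact IsSelfAdjoint.zero _

omit [FiniteDimensional ℝ 𝔸] [Nontrivial 𝔸] in
/-- the class field vanishes off the class. [cite: Balaban1985BackgroundPropagators, (3.16) p.393 («Λ_jQ_j»)] -/
theorem clsField_eq_zero_of_not_mem {ΛbP : ℕ → ℕ → Set (Site d × Fin d)} {η : ℝ} {m j : ℕ} {U₀ : Site d → Fin d → 𝔸ˣ}
    {A : Site d → Fin d → 𝔸} {z : Site d} {κ : Fin d} (h : (z, κ) ∉ ΛbP m j) : clsField L ΛbP η m j U₀ A z κ = 0 := by
  classical
  unfold clsField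
  rw [if_neg h]

/-- ★★ **EDITION P's LETTER `Q*aQ(U₀)` MAPS HERMITIAN FIELDS TO HERMITIAN FIELDS, BOX-CLAUSE FORM (LEVEL-0-EXEMPT, «P₀»)**: for `L ≥ 2`, a faithful Hermitian
tracial `τ`, EVERY unitary `U₀`, a class whose level-`j` bonds for `1 ≤ j ≤ m` have their box in `Ω_{j−1}` (print's (1.31) box law; NO clause at `j = 0`, where
`Q₀ = 1` — dag-n06-b g19's edition P₀, so print's class `cubeLamBP` with its level-0 crossing bonds qualifies), and a Hermitian-valued `A`: `(Q*aQ(U₀)A)(b)` is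
Hermitian at every bond — ON the class (1.7) (window `α_Q∕L²`, read one level up by `reg17_shift`) by §3–§4, OFF it the letter is `0`.  The Hermitian mirror of
dag-n06-b's `QQZdP_add` ∕ `QQZdP_add₀`. [cite: Balaban1985BackgroundPropagators, (3.16) p.393, p.391 («hermitian matrices»); Balaban1985RegularSpaces, (1.7) p.77, (1.31) p.82; Balaban1985Averaging, (127) p.37] -/
theorem isSelfAdjoint_QQZdP_of_box (hL : 2 ≤ L) (hτp : ∀ a : 𝔸, a ≠ 0 → 0 < (τ (star a * a)).re)
    (hτt : ∀ a b : 𝔸, τ (a * b) = τ (b * a)) (hτs : ∀ a : 𝔸, τ (star a) = starRingEnd ℂ (τ a))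
    {ΛbP : ℕ → ℕ → Set (Site d × Fin d)} {i : ZdIdx d L} {m : ℕ}
    (hbox : ∀ j, 1 ≤ j → j ≤ m → ∀ c ∈ ΛbP m j, ∀ x, InBox (loK L j c.1) (bondHiK L j c.1 c.2) x → x ∈ i.Ω (j - 1))
    {U₀ : Site d → Fin d → 𝔸ˣ} (hU₀ : ∀ x κ, U₀ x κ ∈ unitaryUnits 𝔸) {A : Site d → Fin d → 𝔸} (hA : ∀ w κ, IsSelfAdjoint (A w κ))
    (y : Site d) (μ : Fin d) : IsSelfAdjoint (QQZdP τ L ΛbP i m U₀ A y μ) := by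
  have hL1 : 1 ≤ L := le_trans (by norm_num) hL
  have hL0 : (0 : ℝ) < L := by exact_mod_cast (lt_of_lt_of_le (by norm_num) hL)
  by_cases hreg : Reg17 L m i.Ω (alphaQ d L / (L : ℝ) ^ 2) U₀
  · have hreg' : Reg17 L m (fun j => i.Ω (j - 1)) (alphaQ d L) U₀ := by
      have h := reg17_shift hL1 hreg
      rwa [div_mul_cancel₀ _ (by positivity)] at h
    rw [QQZdP_of_reg17 τ L hreg]
    refine isSelfAdjoint_sum _ fun j hjm => ?_
    have hj : j ≤ m := by rw [Finset.mem_range] at hjm; omega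
    refine IsSelfAdjoint.smul (IsSelfAdjoint.all _)
      (isSelfAdjoint_linCovIterT_of_reg17 τ hL hτp hτt hτs (alphaQ_pos d hL1) le_rfl hU₀ hreg' hj
        (fun w κ => isSelfAdjoint_clsField_of_reg17 hL (alphaQ_pos d hL1) le_rfl hU₀ hreg' ΛbP hj (fun hj1 => hbox j hj1 hj) i.η hA w κ)
        (fun hj1 w κ hne => ?_) y μ)
    by_cases hc : (w, κ) ∈ ΛbP m j
    · exact hbox j hj1 hj (w, κ) hc
    · exact absurd (clsField_eq_zero_of_not_mem hc) hne
  · rw [QQZdP_of_not_reg17 τ L hreg]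
    exact IsSelfAdjoint.zero _

/-- **AT A BACKGROUND IN THE CLASS (1.7) ON ALL OF `ℤᵈ` (`Ω ≡ ℤᵈ`, window `α_Q`) EVERY BOX CLAUSE IS VOID** — the regime used below for classes with
crossing bonds (e.g. `cubeLamBP`, whose level-0 crossing bonds leave `□₀`). [cite: Balaban1985RegularSpaces, (1.7) p.77] -/
theorem box_univ (L j : ℕ) (c : Site d × Fin d) :
    ∀ x, InBox (loK L j c.1) (bondHiK L j c.1 c.2) x → x ∈ (fun _ : ℕ => (Set.univ : Set (Site d))) j :=
  fun _ _ => Set.mem_univ _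

/-- ★★ **EDITION P's LETTER IS HERMITIAN-PRESERVING AT EVERY UNITARY BACKGROUND OF THE CLASS (1.7) ON `ℤᵈ` — NO BOX CLAUSE, ANY CLASS `ΛbP`**
(`L ≥ 2`, faithful Hermitian tracial `τ`, `U₀` unitary with `|U₀(∂p) − 1| < α_Q L^{−2j}` for ALL plaquettes `p`, `j ≤ m`). [cite: Balaban1985BackgroundPropagators, (3.16) p.393, p.391; Balaban1985RegularSpaces, (1.7) p.77] -/
theorem isSelfAdjoint_QQZdP_of_reg17Univ (hL : 2 ≤ L) (hτp : ∀ a : 𝔸, a ≠ 0 → 0 < (τ (star a * a)).re)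
    (hτt : ∀ a b : 𝔸, τ (a * b) = τ (b * a)) (hτs : ∀ a : 𝔸, τ (star a) = starRingEnd ℂ (τ a))
    (ΛbP : ℕ → ℕ → Set (Site d × Fin d)) (i : ZdIdx d L) (m : ℕ)
    {U₀ : Site d → Fin d → 𝔸ˣ} (hU₀ : ∀ x κ, U₀ x κ ∈ unitaryUnits 𝔸) (hregU : Reg17 L m (fun _ => (Set.univ : Set (Site d))) (alphaQ d L) U₀)
    {A : Site d → Fin d → 𝔸} (hA : ∀ w κ, IsSelfAdjoint (A w κ)) (y : Site d) (μ : Fin d) :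
    IsSelfAdjoint (QQZdP τ L ΛbP i m U₀ A y μ) := by
  have hL1 : 1 ≤ L := le_trans (by norm_num) hL
  by_cases hreg : Reg17 L m i.Ω (alphaQ d L / (L : ℝ) ^ 2) U₀
  · rw [QQZdP_of_reg17 τ L hreg]
    refine isSelfAdjoint_sum _ fun j hjm => ?_
    have hj : j ≤ m := by rw [Finset.mem_range] at hjm; omega
    exact IsSelfAdjoint.smul (IsSelfAdjoint.all _)
      (isSelfAdjoint_linCovIterT_of_reg17 τ hL hτp hτt hτs (alphaQ_pos d hL1) le_rfl hU₀ hregU hj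
        (fun w κ => isSelfAdjoint_clsField_of_reg17 hL (alphaQ_pos d hL1) le_rfl hU₀ hregU ΛbP hj (fun _ c _ => box_univ L j c) i.η hA w κ)
        (fun _ w κ _ => box_univ L j (w, κ)) y μ)
  · rw [QQZdP_of_not_reg17 τ L hreg]
    exact IsSelfAdjoint.zero _

/-- ★ **EDITION P's LETTER IS ADDITIVE AT EVERY UNITARY BACKGROUND OF THE CLASS (1.7) ON `ℤᵈ` — NO BOX CLAUSE, ANY CLASS** (dag-n06-b's `QQZdP_add` with the
box clause traded for the regime on `Ω ≡ ℤᵈ`; at `U₀ = 1` it is `B9Thm311FlatGreenZdHerm.QQZdP_one_add`). [cite: Balaban1985BackgroundPropagators, (3.16) p.393; Balaban1985Averaging, (122) p.36; Balaban1985RegularSpaces, (1.7) p.77] -/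
theorem QQZdP_add_of_reg17Univ (hL : 2 ≤ L) (ΛbP : ℕ → ℕ → Set (Site d × Fin d)) (i : ZdIdx d L) (m : ℕ)
    {U₀ : Site d → Fin d → 𝔸ˣ} (hU₀ : ∀ x κ, U₀ x κ ∈ unitaryUnits 𝔸) (hregU : Reg17 L m (fun _ => (Set.univ : Set (Site d))) (alphaQ d L) U₀)
    (A A' : Site d → Fin d → 𝔸) :
    QQZdP τ L ΛbP i m U₀ (A + A') = QQZdP τ L ΛbP i m U₀ A + QQZdP τ L ΛbP i m U₀ A' := by
  have hL1 : 1 ≤ L := le_trans (by norm_num) hL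
  funext y μ
  simp only [Pi.add_apply]
  by_cases hreg : Reg17 L m i.Ω (alphaQ d L / (L : ℝ) ^ 2) U₀
  · rw [QQZdP_of_reg17 τ L hreg, QQZdP_of_reg17 τ L hreg, QQZdP_of_reg17 τ L hreg, ← Finset.sum_add_distrib]
    refine Finset.sum_congr rfl fun j hjm => ?_
    have hj : j ≤ m := by rw [Finset.mem_range] at hjm; omega
    rw [clsField_add_of_reg17 hL (alphaQ_pos d hL1) le_rfl hU₀ hregU ΛbP hj (fun c _ => box_univ L j c) i.η A A', linCovIterT_add, smul_add]
  · rw [QQZdP_of_not_reg17 τ L hreg, QQZdP_of_not_reg17 τ L hreg, QQZdP_of_not_reg17 τ L hreg, add_zero]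

/-- ★ **EDITION P's LETTER IS REAL-HOMOGENEOUS AT EVERY UNITARY BACKGROUND OF THE CLASS (1.7) ON `ℤᵈ` — NO BOX CLAUSE, ANY CLASS.**
[cite: Balaban1985BackgroundPropagators, (3.16) p.393; Balaban1985Averaging, (122) p.36; Balaban1985RegularSpaces, (1.7) p.77] -/
theorem QQZdP_smul_real_of_reg17Univ (hL : 2 ≤ L) (ΛbP : ℕ → ℕ → Set (Site d × Fin d)) (i : ZdIdx d L) (m : ℕ)
    {U₀ : Site d → Fin d → 𝔸ˣ} (hU₀ : ∀ x κ, U₀ x κ ∈ unitaryUnits 𝔸) (hregU : Reg17 L m (fun _ => (Set.univ : Set (Site d))) (alphaQ d L) U₀)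
    (r : ℝ) (A : Site d → Fin d → 𝔸) :
    QQZdP τ L ΛbP i m U₀ (r • A) = r • QQZdP τ L ΛbP i m U₀ A := by
  have hL1 : 1 ≤ L := le_trans (by norm_num) hL
  funext y μ
  simp only [Pi.smul_apply]
  by_cases hreg : Reg17 L m i.Ω (alphaQ d L / (L : ℝ) ^ 2) U₀
  · rw [QQZdP_of_reg17 τ L hreg, QQZdP_of_reg17 τ L hreg, Finset.smul_sum]
    refine Finset.sum_congr rfl fun j hjm => ?_
    have hj : j ≤ m := by rw [Finset.mem_range] at hjm; omega
    rw [clsField_smul_of_reg17 hL (alphaQ_pos d hL1) le_rfl hU₀ hregU ΛbP hj (fun c _ => box_univ L j c) i.η r A, linCovIterT_smul, smul_comm]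
  · rw [QQZdP_of_not_reg17 τ L hreg, QQZdP_of_not_reg17 τ L hreg, smul_zero]

/-- ★ **`QQLinearAt` FOR EDITION P AT EVERY UNITARY BACKGROUND OF THE CLASS (1.7) ON `ℤᵈ`, ANY CLASS.** [cite: Balaban1985BackgroundPropagators, (3.16) p.393 («an operator Q*aQ»)] -/
theorem qqLinearAt_withQQP_of_reg17Univ (hL : 2 ≤ L) (ΛbP : ℕ → ℕ → Set (Site d × Fin d)) (ops₀ : ℝ → ZdIdx d L → ℕ → OpsZd d 𝔸) (M : ℝ)
    (i : ZdIdx d L) (m : ℕ) {U₀ : Site d → Fin d → 𝔸ˣ} (hU₀ : ∀ x κ, U₀ x κ ∈ unitaryUnits 𝔸)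
    (hregU : Reg17 L m (fun _ => (Set.univ : Set (Site d))) (alphaQ d L) U₀) : QQLinearAt (withQQP τ L ΛbP ops₀ M i m) U₀ :=
  ⟨{ toFun := QQZdP τ L ΛbP i m U₀, map_add' := QQZdP_add_of_reg17Univ τ hL ΛbP i m hU₀ hregU,
      map_smul' := QQZdP_smul_real_of_reg17Univ τ hL ΛbP i m hU₀ hregU }, fun _ => rfl⟩

end Letter

/-! ## §5 The four-letter `Δ_a(U₀)` of the genuine record: `LinearOnDomAt` and `HermPreservingAt` on the class (1.7) on `ℤᵈ` -/

section Assembly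

variable (τ : 𝔸 →ₗ[ℂ] ℂ) [FiniteDimensional ℝ 𝔸] [Nontrivial 𝔸] {L : ℕ}

/-- ★★★ **`Δ_a(U₀)` OF THE FOUR-LETTER RECORD IS THE RESTRICTION OF AN ℝ-LINEAR MAP AT EVERY UNITARY `U₀` OF THE CLASS (1.7) ON `ℤᵈ`** — every member with
finite `Ω₀`, EVERY class `ΛbP` (crossing bonds allowed: no box clause), `L ≥ 2`; the curved-background twin of dag-n06-b's `linearOnDomAt_opsAllZd_one`.
[cite: Balaban1985BackgroundPropagators, (3.26) p.395 (Δ_a is a linear operator); Balaban1985RegularSpaces, (1.7) p.77] -/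
theorem linearOnDomAt_opsAllZd_of_reg17Univ (hL : 2 ≤ L) (ΛbP : ℕ → ℕ → Set (Site d × Fin d)) (ops₀ : ℝ → ZdIdx d L → ℕ → OpsZd d 𝔸)
    (M : ℝ) (i : ZdIdx d L) (m : ℕ) (hΩ : (i.Ω 0).Finite) {U₀ : Site d → Fin d → 𝔸ˣ} (hU₀ : ∀ x κ, U₀ x κ ∈ unitaryUnits 𝔸)
    (hregU : Reg17 L m (fun _ => (Set.univ : Set (Site d))) (alphaQ d L) U₀) :
    LinearOnDomAt i.η (opsAllZd τ L ΛbP ops₀ M i m) (i.Ω 0) U₀ :=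
  linearOnDomAt_opsGenuine τ (withQQP τ L ΛbP ops₀) M i m hΩ U₀ (qqLinearAt_withQQP_of_reg17Univ τ hL ΛbP ops₀ M i m hU₀ hregU)

/-- ★★★ **`Δ_a(U₀)` OF THE FOUR-LETTER RECORD MAPS HERMITIAN FIELDS OF `E(Ω₀)` TO HERMITIAN BOND FIELDS AT EVERY UNITARY `U₀` OF THE CLASS (1.7) ON `ℤᵈ`**
(`HermPreservingAt`; finite `Ω₀`, `L ≥ 2`, any class, faithful Hermitian tracial `τ` on a finite-dimensional fibre): `D*D`, `Δ′`, `D R(U₀) 𝟙D*` at every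
unitary background (dag-n06-w2 g2's `isSelfAdjoint_deltaAOf_opsAllZd_of_QQ`) and the averaging letter by §4 — the curved-background twin of
`B9Thm311FlatGreenZdHerm.hermPreservingAt_opsAllZd_one`; the conclusion holds at EVERY bond, touching `Ω₀` or not. [cite: Balaban1985BackgroundPropagators, p.391 («values in the algebra 𝔤 of hermitian matrices»), (3.26) p.395, (3.16) p.393; Balaban1985RegularSpaces, (1.7) p.77] -/
theorem hermPreservingAt_opsAllZd_of_reg17Univ (hτt : ∀ a b : 𝔸, τ (a * b) = τ (b * a)) (hτs : ∀ a : 𝔸, τ (star a) = starRingEnd ℂ (τ a))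
    (hτp : ∀ a : 𝔸, a ≠ 0 → 0 < (τ (star a * a)).re) (hL : 2 ≤ L) (ΛbP : ℕ → ℕ → Set (Site d × Fin d))
    (ops₀ : ℝ → ZdIdx d L → ℕ → OpsZd d 𝔸) (M : ℝ) (i : ZdIdx d L) (m : ℕ) (hΩ : (i.Ω 0).Finite)
    {U₀ : Site d → Fin d → 𝔸ˣ} (hU₀ : ∀ x κ, U₀ x κ ∈ unitaryUnits 𝔸) (hregU : Reg17 L m (fun _ => (Set.univ : Set (Site d))) (alphaQ d L) U₀) :
    HermPreservingAt i.η (opsAllZd τ L ΛbP ops₀ M i m) (i.Ω 0) U₀ := by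
  intro A hA y μ _
  refine isSelfAdjoint_deltaAOf_opsAllZd_of_QQ τ hτs hτp ΛbP ops₀ M i m hΩ hU₀ hA.2 y μ ?_
  rw [B9SupplySockB9P3ZdAllLettersZd.opsAllZd_QQ]
  exact isSelfAdjoint_QQZdP_of_reg17Univ τ hL hτp hτt hτs ΛbP i m hU₀ hregU hA.2 y μ

/-- ★★ **BOX-CLAUSE FORM (LEVEL-0-EXEMPT, «P₀»): `Δ_a(U₀)` OF THE FOUR-LETTER RECORD IS HERMITIAN-PRESERVING AT EVERY UNITARY BACKGROUND** for classes whose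
level-`j` bonds, `1 ≤ j ≤ m`, obey print's (1.31) box law (finite `Ω₀`, `L ≥ 2`, faithful Hermitian tracial `τ` on a finite-dimensional fibre) — no regime hypothesis on
`U₀` (§4 `isSelfAdjoint_QQZdP_of_box` + dag-n06-w2 g2's three unitary-background letters); print's class `cubeLamBP` qualifies (dag-n06-b g19's `hbox0_cubeLamBP`).
[cite: Balaban1985BackgroundPropagators, p.391, (3.26) p.395, (3.16) p.393; Balaban1985RegularSpaces, (1.31) p.82] -/
theorem hermPreservingAt_opsAllZd_of_box (hτt : ∀ a b : 𝔸, τ (a * b) = τ (b * a)) (hτs : ∀ a : 𝔸, τ (star a) = starRingEnd ℂ (τ a))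
    (hτp : ∀ a : 𝔸, a ≠ 0 → 0 < (τ (star a * a)).re) (hL : 2 ≤ L) {ΛbP : ℕ → ℕ → Set (Site d × Fin d)}
    (ops₀ : ℝ → ZdIdx d L → ℕ → OpsZd d 𝔸) (M : ℝ) {i : ZdIdx d L} {m : ℕ} (hΩ : (i.Ω 0).Finite)
    (hbox : ∀ j, 1 ≤ j → j ≤ m → ∀ c ∈ ΛbP m j, ∀ x, InBox (loK L j c.1) (bondHiK L j c.1 c.2) x → x ∈ i.Ω (j - 1))
    {U₀ : Site d → Fin d → 𝔸ˣ} (hU₀ : ∀ x κ, U₀ x κ ∈ unitaryUnits 𝔸) :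
    HermPreservingAt i.η (opsAllZd τ L ΛbP ops₀ M i m) (i.Ω 0) U₀ := by
  intro A hA y μ _
  refine isSelfAdjoint_deltaAOf_opsAllZd_of_QQ τ hτs hτp ΛbP ops₀ M i m hΩ hU₀ hA.2 y μ ?_
  rw [B9SupplySockB9P3ZdAllLettersZd.opsAllZd_QQ]
  exact isSelfAdjoint_QQZdP_of_box τ hL hτp hτt hτs hbox hU₀ hA.2 y μ

omit [FiniteDimensional ℝ 𝔸] [Nontrivial 𝔸] in
/-- **A6 — THE REGIME IS INHABITED BY THE FLAT BACKGROUND**: `U₀ = 1` is unitary-valued and lies in the class (1.7) on `ℤᵈ` at window `α_Q` (`L ≥ 1`), so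
the background set `𝒰 = {U₀ unitary, (1.7) on ℤᵈ up to level m}` of the two theorems above contains `1` (the `h1` of dag-n06-w4's step-(ii) engine).
[cite: Balaban1985RegularSpaces, (1.7) p.77] -/
theorem one_mem_reg17Univ (hL : 1 ≤ L) (m : ℕ) :
    (1 : Site d → Fin d → 𝔸ˣ) ∈ {U₀ : Site d → Fin d → 𝔸ˣ | (∀ x κ, U₀ x κ ∈ unitaryUnits 𝔸) ∧
        Reg17 L m (fun _ => (Set.univ : Set (Site d))) (alphaQ d L) U₀} :=
  ⟨fun _ _ => (unitaryUnits 𝔸).one_mem, reg17_one hL (alphaQ_pos d hL)⟩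

/-- ★★ **THE TWO STRUCTURAL INPUTS OF THE STEP-(ii) ENGINE ON THE SET `𝒰` OF UNITARY BACKGROUNDS IN THE CLASS (1.7) ON `ℤᵈ`** (dag-n06-w4's
`B9Thm311PosDefOpenZd.regularAtH_eventually_one_cube` hypotheses `hlin`, `hherm`, for ANY class incl. `cubeLamBP`): for every `U₀ ∈ 𝒰`, `Δ_a(U₀)` of the
four-letter record is ℝ-linear on `E(Ω₀)` and Hermitian-preserving on `E_𝔤(Ω₀)`; and `1 ∈ 𝒰` (`one_mem_reg17Univ`). [cite: Balaban1985BackgroundPropagators, (3.26) p.395, Thm 3.11 p.416; Balaban1985RegularSpaces, (1.7) p.77] -/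
theorem linear_herm_on_reg17Univ (hτt : ∀ a b : 𝔸, τ (a * b) = τ (b * a)) (hτs : ∀ a : 𝔸, τ (star a) = starRingEnd ℂ (τ a))
    (hτp : ∀ a : 𝔸, a ≠ 0 → 0 < (τ (star a * a)).re) (hL : 2 ≤ L) (ΛbP : ℕ → ℕ → Set (Site d × Fin d))
    (ops₀ : ℝ → ZdIdx d L → ℕ → OpsZd d 𝔸) (M : ℝ) (i : ZdIdx d L) (m : ℕ) (hΩ : (i.Ω 0).Finite) :
    (∀ U₀ ∈ {U₀ : Site d → Fin d → 𝔸ˣ | (∀ x κ, U₀ x κ ∈ unitaryUnits 𝔸) ∧ Reg17 L m (fun _ => (Set.univ : Set (Site d))) (alphaQ d L) U₀},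
        LinearOnDomAt i.η (opsAllZd τ L ΛbP ops₀ M i m) (i.Ω 0) U₀) ∧
      (∀ U₀ ∈ {U₀ : Site d → Fin d → 𝔸ˣ | (∀ x κ, U₀ x κ ∈ unitaryUnits 𝔸) ∧ Reg17 L m (fun _ => (Set.univ : Set (Site d))) (alphaQ d L) U₀},
        HermPreservingAt i.η (opsAllZd τ L ΛbP ops₀ M i m) (i.Ω 0) U₀) :=
  ⟨fun _ hU => linearOnDomAt_opsAllZd_of_reg17Univ τ hL ΛbP ops₀ M i m hΩ hU.1 hU.2,
    fun _ hU => hermPreservingAt_opsAllZd_of_reg17Univ τ hτt hτs hτp hL ΛbP ops₀ M i m hΩ hU.1 hU.2⟩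

omit [FiniteDimensional ℝ 𝔸] [Nontrivial 𝔸] in
/-- the class (1.7) on `ℤᵈ` at the letter's own window `α_Q∕L²` (dag-n06-w3 g3's `QQZdP_gaugeAct_of_reg17Univ`, where the letter's guard holds at every
member) lies in the class at window `α_Q` (`L ≥ 1`). [cite: Balaban1985RegularSpaces, (1.7) p.77] -/
theorem reg17Univ_of_reg17UnivP (hL : 1 ≤ L) {m : ℕ} {U₀ : Site d → Fin d → 𝔸ˣ}
    (h : Reg17 L m (fun _ => (Set.univ : Set (Site d))) (alphaQ d L / (L : ℝ) ^ 2) U₀) :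
    Reg17 L m (fun _ => (Set.univ : Set (Site d))) (alphaQ d L) U₀ := by
  refine reg17_mono ?_ h
  have hL' : (1 : ℝ) ≤ L := by exact_mod_cast hL
  have hL2 : (1 : ℝ) ≤ (L : ℝ) ^ 2 := one_le_pow₀ hL'
  exact div_le_self (alphaQ_pos d hL).le hL2

omit [FiniteDimensional ℝ 𝔸] [Nontrivial 𝔸] in
/-- **A6 at the letter's own window**: `U₀ = 1` lies in `𝒰′ = {U₀ unitary, (1.7) on ℤᵈ up to level m at window α_Q∕L²}` (`L ≥ 1`).
[cite: Balaban1985RegularSpaces, (1.7) p.77] -/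
theorem one_mem_reg17UnivP (hL : 1 ≤ L) (m : ℕ) :
    (1 : Site d → Fin d → 𝔸ˣ) ∈ {U₀ : Site d → Fin d → 𝔸ˣ | (∀ x κ, U₀ x κ ∈ unitaryUnits 𝔸) ∧
        Reg17 L m (fun _ => (Set.univ : Set (Site d))) (alphaQ d L / (L : ℝ) ^ 2) U₀} := by
  have hL0 : (0 : ℝ) < (L : ℝ) ^ 2 := by positivity
  exact ⟨fun _ _ => (unitaryUnits 𝔸).one_mem, reg17_one hL (div_pos (alphaQ_pos d hL) hL0)⟩

/-- ★★ **THE SAME PACKAGE ON `𝒰′` — THE CLASS (1.7) ON `ℤᵈ` AT THE LETTER'S OWN WINDOW `α_Q∕L²`** (dag-n06-w3 g3's regime for the gauge covariance of `Q*aQ`,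
`QQZdP_gaugeAct_of_reg17Univ`; on `𝒰′` the letter's guard holds at every member, so `Q*aQ(U₀)` is print's genuine sum there): for every `U₀ ∈ 𝒰′`,
`Δ_a(U₀)` is ℝ-linear on `E(Ω₀)` and Hermitian-preserving on `E_𝔤(Ω₀)`; `1 ∈ 𝒰′` (`one_mem_reg17UnivP`). [cite: Balaban1985BackgroundPropagators, (3.26) p.395, Thm 3.11 p.416; Balaban1985RegularSpaces, (1.7) p.77] -/
theorem linear_herm_on_reg17UnivP (hτt : ∀ a b : 𝔸, τ (a * b) = τ (b * a)) (hτs : ∀ a : 𝔸, τ (star a) = starRingEnd ℂ (τ a))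
    (hτp : ∀ a : 𝔸, a ≠ 0 → 0 < (τ (star a * a)).re) (hL : 2 ≤ L) (ΛbP : ℕ → ℕ → Set (Site d × Fin d))
    (ops₀ : ℝ → ZdIdx d L → ℕ → OpsZd d 𝔸) (M : ℝ) (i : ZdIdx d L) (m : ℕ) (hΩ : (i.Ω 0).Finite) :
    (∀ U₀ ∈ {U₀ : Site d → Fin d → 𝔸ˣ | (∀ x κ, U₀ x κ ∈ unitaryUnits 𝔸) ∧
          Reg17 L m (fun _ => (Set.univ : Set (Site d))) (alphaQ d L / (L : ℝ) ^ 2) U₀},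
        LinearOnDomAt i.η (opsAllZd τ L ΛbP ops₀ M i m) (i.Ω 0) U₀) ∧
      (∀ U₀ ∈ {U₀ : Site d → Fin d → 𝔸ˣ | (∀ x κ, U₀ x κ ∈ unitaryUnits 𝔸) ∧
          Reg17 L m (fun _ => (Set.univ : Set (Site d))) (alphaQ d L / (L : ℝ) ^ 2) U₀},
        HermPreservingAt i.η (opsAllZd τ L ΛbP ops₀ M i m) (i.Ω 0) U₀) := by
  have hL1 : 1 ≤ L := le_trans (by norm_num) hL
  exact ⟨fun _ hU => linearOnDomAt_opsAllZd_of_reg17Univ τ hL ΛbP ops₀ M i m hΩ hU.1 (reg17Univ_of_reg17UnivP hL1 hU.2),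
    fun _ hU => hermPreservingAt_opsAllZd_of_reg17Univ τ hτt hτs hτp hL ΛbP ops₀ M i m hΩ hU.1 (reg17Univ_of_reg17UnivP hL1 hU.2)⟩

end Assembly

end Literature.MathematicalPhysics.QuantumFieldTheory.Balaban1983to89.B9Eq326DeltaAHermitianZdCurved

end
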